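import Mathlib
import Summits.Ventures.PercRepro2.SwOutMultiRootEDefs
import Summits.Ventures.PercRepro2.SwOutMultiRootCube

/-!
# The multi-root core cube with root–root edges: the cluster monotonicities (blind cell
PercRepro2, night-4 g34, 2026-08-29; proofs/NIGHT4-G34.md §8)

The graph lemma `cluster_subset_of_le_within` (a cluster inside a closed set transports to any
colouring that is larger on the edges inside the set) and the four cluster monotonicities of the
cube with root–root coordinates: the red cluster of a root is increasing in the cube point, the
blue one decreasing, the clusters of an outside vertex the other way — a root–root edge red at `ω`
is red at every `ω' ≥ ω`, an edge with an end in an arm has the same colour at two cube points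
agreeing on that arm.
-/

namespace Summit.Ventures.PercRepro2

namespace LocRows

open Hull

variable {V : Type*} {E : Type*}

open scoped Classical

variable {ends : E → Sym2 V}

section Agree

/-- **Clusters through a closed set, monotone form**: if the red cluster of `v` in `ω₁` stays inside
a set `S` closed under red adjacency, and every red edge of `ω₁` inside `S` is red in `ω₂`, then the
cluster of `v` in `ω₁` lies in its cluster in `ω₂`. -/
lemma cluster_subset_of_le_within {ω₁ ω₂ : Config E} {S : Set V} {v : V}
    (hS : ∀ x ∈ S, ∀ y, (openGraph ends ω₁).Adj x y → y ∈ S) (hv : v ∈ S)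
    (hle : ∀ e ∈ within ends S, ω₁ e = true → ω₂ e = true) :
    cluster ends ω₁ v ⊆ cluster ends ω₂ v := by
  let ρ : Config E := fun e => ω₁ e && decide (e ∈ within ends S)
  have hρ₁ : ρ ≤ ω₁ := fun e => by simp only [ρ]; cases ω₁ e <;> simp
  have hρS : cluster ends ρ v ⊆ S := by
    intro x hx
    refine mem_of_conn_of_closed (ends := ends) (ω := ρ) ?_ hv hx
    intro x hx y hxy
    exact hS x hx y ((openGraph_mono hρ₁) hxy)
  have h1 : cluster ends ω₁ v ⊆ cluster ends ρ v := by
    intro x hx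
    refine mem_of_conn_of_closed (ends := ends) (ω := ω₁) ?_ (mem_cluster_self _ _ _) hx
    intro x hx y hxy
    have hxS : x ∈ S := hρS hx
    have hyS : y ∈ S := hS x hxS y hxy
    obtain ⟨_, e, he, hxy'⟩ := exists_edge_of_adj hxy
    have hρe : ρ e = true := by
      simp only [ρ, he, Bool.true_and, decide_eq_true_eq]
      exact ⟨x, hxS, y, hyS, hxy'⟩
    exact mem_cluster_of_edge hx hρe hxy'
  have hρ₂ : ρ ≤ ω₂ := by
    intro e
    by_cases he : ρ e = true
    · rw [he]
      have h' : ω₁ e = true ∧ e ∈ within ends S := by simpa [ρ] using he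
      rw [hle e h'.2 h'.1]
    · simp only [Bool.not_eq_true] at he
      rw [he]; exact Bool.false_le _
  exact h1.trans (cluster_mono hρ₂ v)

end Agree

section Cube

variable {ι : Type*} {A : ι → Set V} {ζ : Config E} {R H : Set V} {RR : Finset E}
  (hb : MultiBaseE ends ζ R H A RR)
include hb

omit hb in
/-- An edge touching the arms has an end in some arm. -/
lemma MultiBaseE.exists_arm_of_touches_allArms {e : E} (he : e ∈ touches ends (allArms A)) :
    ∃ i x y, ends e = s(x, y) ∧ x ∈ A i := by
  obtain ⟨x, ⟨i, hx⟩, y, hxy⟩ := he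
  exact ⟨i, x, y, hxy, hx⟩

/-- Two cube points agreeing on the arm of an end of an edge (and on the edge, if it joins two
roots) colour that edge alike. -/
lemma MultiBaseE.coreRealRR_eq_of_agree {ω ω' : Config (ι ⊕ ↥RR)} {e : E}
    (hag : ∀ i, (∃ x ∈ A i, x ∈ ends e) → ω (Sum.inl i) = ω' (Sum.inl i))
    (hrr : ∀ he : e ∈ RR, ω (Sum.inr ⟨e, he⟩) = ω' (Sum.inr ⟨e, he⟩)) :
    coreRealRR ends A RR ζ ω e = coreRealRR ends A RR ζ ω' e := by
  by_cases he : e ∈ RR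
  · rw [coreRealRR_apply_rr he, coreRealRR_apply_rr he, hrr he]
  by_cases ht : e ∈ touches ends (allArms A)
  · obtain ⟨i, x, y, hxy, hx⟩ := MultiBaseE.exists_arm_of_touches_allArms ht
    rw [hb.coreRealRR_apply_of_mem hxy hx, hb.coreRealRR_apply_of_mem hxy hx,
      hag i ⟨x, hx, by rw [hxy]; exact Sym2.mem_mk_left x y⟩]
  · rw [MultiBaseE.coreRealRR_apply_of_notMem ht he, MultiBaseE.coreRealRR_apply_of_notMem ht he]

/-- The arm of a vertex of `R ∪ armsTrueC ω` is `true`. -/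
lemma MultiBaseE.armPart_of_mem_true {ω : Config ι} {z : V} {i : ι}
    (hz : z ∈ R ∪ armsTrueC A ω) (hzi : z ∈ A i) : ω i = true := by
  rcases hz with hz | ⟨j, hj, hz⟩
  · exact absurd hzi (hb.root_notMem_arm hz i)
  · have hji : j = i := by
      by_contra hne
      exact hb.arm_disj j i hne z hz hzi
    rw [← hji]; exact hj

/-- The arm of a vertex of `R ∪ armsFalseC ω` is `false`. -/
lemma MultiBaseE.armPart_of_mem_false {ω : Config ι} {z : V} {i : ι}
    (hz : z ∈ R ∪ armsFalseC A ω) (hzi : z ∈ A i) : ω i = false := by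
  rcases hz with hz | ⟨j, hj, hz⟩
  · exact absurd hzi (hb.root_notMem_arm hz i)
  · have hji : j = i := by
      by_contra hne
      exact hb.arm_disj j i hne z hz hzi
    rw [← hji]; exact hj

/-- A red edge inside `R ∪ armsTrueC ω` is red at every `ω' ≥ ω`. -/
lemma MultiBaseE.coreRealRR_le_of_within_true {ω ω' : Config (ι ⊕ ↥RR)} (hω : ω ≤ ω') {e : E}
    (he : e ∈ within ends (R ∪ armsTrueC A (armPart ω)))
    (hred : coreRealRR ends A RR ζ ω e = true) : coreRealRR ends A RR ζ ω' e = true := by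
  by_cases hrr : e ∈ RR
  · rw [hb.coreRealRR_rr_edge hrr] at hred ⊢
    have := hω (Sum.inr ⟨e, hrr⟩); rw [hred] at this; exact Bool.eq_true_of_true_le this
  · rw [← hred]
    refine (hb.coreRealRR_eq_of_agree (fun i ⟨x, hx, hxe⟩ => ?_) (fun h' => absurd h' hrr)).symm
    obtain ⟨a, ha, b, hb', hab⟩ := he
    rw [hab, Sym2.mem_iff] at hxe
    have hi : armPart ω i = true := by
      rcases hxe with rfl | rfl
      · exact hb.armPart_of_mem_true ha hx
      · exact hb.armPart_of_mem_true hb' hx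
    have hi' : ω' (Sum.inl i) = true := by
      have := hω (Sum.inl i); simp only [armPart] at hi; rw [hi] at this
      exact Bool.eq_true_of_true_le this
    simp only [armPart] at hi
    rw [hi, hi']

/-- A blue edge inside `R ∪ armsFalseC ω'` is blue at every `ω ≤ ω'`. -/
lemma MultiBaseE.coreRealRR_blue_of_within_false {ω ω' : Config (ι ⊕ ↥RR)} (hω : ω ≤ ω') {e : E}
    (he : e ∈ within ends (R ∪ armsFalseC A (armPart ω')))
    (hblue : coreRealRR ends A RR ζ ω' e = false) : coreRealRR ends A RR ζ ω e = false := by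
  by_cases hrr : e ∈ RR
  · have h1 := hb.coreRealRR_rr_edge (ω := ω') hrr
    have h2 := hb.coreRealRR_rr_edge (ω := ω) hrr
    have hω'' : ω' (Sum.inr ⟨e, hrr⟩) = false := by
      by_contra h'; rw [Bool.not_eq_false] at h'; rw [h1.2 h'] at hblue; simp at hblue
    have hω₀ : ω (Sum.inr ⟨e, hrr⟩) = false := by
      have := hω (Sum.inr ⟨e, hrr⟩); rw [hω''] at this; exact Bool.eq_false_of_le_false this
    by_contra h'; rw [Bool.not_eq_false] at h'
    rw [h2.1 h'] at hω₀; simp at hω₀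
  · rw [← hblue]
    refine hb.coreRealRR_eq_of_agree (fun i ⟨x, hx, hxe⟩ => ?_) (fun h' => absurd h' hrr)
    obtain ⟨a, ha, b, hb', hab⟩ := he
    rw [hab, Sym2.mem_iff] at hxe
    have hi' : armPart ω' i = false := by
      rcases hxe with rfl | rfl
      · exact hb.armPart_of_mem_false ha hx
      · exact hb.armPart_of_mem_false hb' hx
    simp only [armPart] at hi'
    have hi : ω (Sum.inl i) = false := by
      have := hω (Sum.inl i); rw [hi'] at this; exact Bool.eq_false_of_le_false this
    rw [hi, hi']

/-- An edge inside `Hᶜ ∪ armsFalseC ω'` has the same colour at `ω'` and at every `ω ≤ ω'`. -/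
lemma MultiBaseE.coreRealRR_eq_of_within_out_false {ω ω' : Config (ι ⊕ ↥RR)} (hω : ω ≤ ω') {e : E}
    (he : e ∈ within ends (Hᶜ ∪ armsFalseC A (armPart ω'))) :
    coreRealRR ends A RR ζ ω' e = coreRealRR ends A RR ζ ω e := by
  obtain ⟨a, ha, b, hb', hab⟩ := he
  have hrr : e ∉ RR := by
    intro hrr
    obtain ⟨r, hr, r', hr', hrr'⟩ := (hb.rr_iff e).1 hrr
    rw [hab, Sym2.eq_iff] at hrr'
    have key : ∀ z, z ∈ Hᶜ ∪ armsFalseC A (armPart ω') → z ∈ R → False := by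
      rintro z (hz | ⟨i, _, hz⟩) hzR
      · exact hz (hb.root_sub hzR)
      · exact hb.root_notMem_arm hzR i hz
    rcases hrr' with ⟨rfl, -⟩ | ⟨rfl, -⟩
    · exact key a ha hr
    · exact key a ha hr'
  refine hb.coreRealRR_eq_of_agree (fun i ⟨x, hx, hxe⟩ => ?_) (fun h' => absurd h' hrr)
  rw [hab, Sym2.mem_iff] at hxe
  have key : ∀ z, z ∈ Hᶜ ∪ armsFalseC A (armPart ω') → z ∈ A i → armPart ω' i = false := by
    rintro z (hz | ⟨j, hj, hz⟩) hzi
    · exact absurd (hb.arm_sub i z hzi).1 hz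
    · have hji : j = i := by
        by_contra hne
        exact hb.arm_disj j i hne z hz hzi
      rw [← hji]; exact hj
  have hi' : armPart ω' i = false := by
    rcases hxe with rfl | rfl
    · exact key x ha hx
    · exact key x hb' hx
  simp only [armPart] at hi'
  have hi : ω (Sum.inl i) = false := by
    have := hω (Sum.inl i); rw [hi'] at this; exact Bool.eq_false_of_le_false this
  rw [hi, hi']

/-- An edge inside `Hᶜ ∪ armsTrueC ω` has the same colour at `ω` and at every `ω' ≥ ω`. -/
lemma MultiBaseE.coreRealRR_eq_of_within_out_true {ω ω' : Config (ι ⊕ ↥RR)} (hω : ω ≤ ω') {e : E}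
    (he : e ∈ within ends (Hᶜ ∪ armsTrueC A (armPart ω))) :
    coreRealRR ends A RR ζ ω e = coreRealRR ends A RR ζ ω' e := by
  obtain ⟨a, ha, b, hb', hab⟩ := he
  have hrr : e ∉ RR := by
    intro hrr
    obtain ⟨r, hr, r', hr', hrr'⟩ := (hb.rr_iff e).1 hrr
    rw [hab, Sym2.eq_iff] at hrr'
    have key : ∀ z, z ∈ Hᶜ ∪ armsTrueC A (armPart ω) → z ∈ R → False := by
      rintro z (hz | ⟨i, _, hz⟩) hzR
      · exact hz (hb.root_sub hzR)
      · exact hb.root_notMem_arm hzR i hz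
    rcases hrr' with ⟨rfl, -⟩ | ⟨rfl, -⟩
    · exact key a ha hr
    · exact key a ha hr'
  refine hb.coreRealRR_eq_of_agree (fun i ⟨x, hx, hxe⟩ => ?_) (fun h' => absurd h' hrr)
  rw [hab, Sym2.mem_iff] at hxe
  have key : ∀ z, z ∈ Hᶜ ∪ armsTrueC A (armPart ω) → z ∈ A i → armPart ω i = true := by
    rintro z (hz | ⟨j, hj, hz⟩) hzi
    · exact absurd (hb.arm_sub i z hzi).1 hz
    · have hji : j = i := by
        by_contra hne
        exact hb.arm_disj j i hne z hz hzi
      rw [← hji]; exact hj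
  have hi : armPart ω i = true := by
    rcases hxe with rfl | rfl
    · exact key x ha hx
    · exact key x hb' hx
  simp only [armPart] at hi
  have hi' : ω' (Sum.inl i) = true := by
    have := hω (Sum.inl i); rw [hi] at this; exact Bool.eq_true_of_true_le this
  rw [hi, hi']

/-! ### The monotonicities -/

/-- The red cluster of a root is increasing in the cube point. -/
theorem MultiBaseE.cluster_coreRealRR_mono {r : V} (hr : r ∈ R) {ω ω' : Config (ι ⊕ ↥RR)}
    (hω : ω ≤ ω') :
    cluster ends (coreRealRR ends A RR ζ ω) r ⊆ cluster ends (coreRealRR ends A RR ζ ω') r :=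
  cluster_subset_of_le_within (S := R ∪ armsTrueC A (armPart ω))
    (fun _ hx _ hxy => hb.red_closed ω hx hxy) (Or.inl hr)
    (fun _ he hred => hb.coreRealRR_le_of_within_true hω he hred)

/-- The blue cluster of a root is decreasing in the cube point. -/
theorem MultiBaseE.cluster_blue_coreRealRR_anti {r : V} (hr : r ∈ R) {ω ω' : Config (ι ⊕ ↥RR)}
    (hω : ω ≤ ω') :
    cluster ends (blue (coreRealRR ends A RR ζ ω')) r ⊆
      cluster ends (blue (coreRealRR ends A RR ζ ω)) r :=
  cluster_subset_of_le_within (S := R ∪ armsFalseC A (armPart ω'))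
    (fun _ hx _ hxy => hb.blue_closed ω' hx hxy) (Or.inl hr)
    (fun e he hblue => by
      rw [blue_eq_true_iff] at hblue ⊢
      exact hb.coreRealRR_blue_of_within_false hω he hblue)

/-- The red cluster of an outside vertex is decreasing in the cube point. -/
theorem MultiBaseE.cluster_out_coreRealRR_anti {y : V} (hy : y ∉ H) {ω ω' : Config (ι ⊕ ↥RR)}
    (hω : ω ≤ ω') :
    cluster ends (coreRealRR ends A RR ζ ω') y ⊆ cluster ends (coreRealRR ends A RR ζ ω) y :=
  cluster_subset_of_le_within (S := Hᶜ ∪ armsFalseC A (armPart ω'))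
    (fun _ hx _ hxy => hb.red_closed_out ω' hx hxy) (Or.inl hy)
    (fun _ he hred => by rw [← hb.coreRealRR_eq_of_within_out_false hω he]; exact hred)

/-- The blue cluster of an outside vertex is increasing in the cube point. -/
theorem MultiBaseE.cluster_blue_out_coreRealRR_mono {y : V} (hy : y ∉ H) {ω ω' : Config (ι ⊕ ↥RR)}
    (hω : ω ≤ ω') :
    cluster ends (blue (coreRealRR ends A RR ζ ω)) y ⊆
      cluster ends (blue (coreRealRR ends A RR ζ ω')) y :=
  cluster_subset_of_le_within (S := Hᶜ ∪ armsTrueC A (armPart ω))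
    (fun _ hx _ hxy => hb.blue_closed_out ω hx hxy) (Or.inl hy)
    (fun e he hblue => by
      rw [blue_eq_true_iff] at hblue ⊢
      rw [← hb.coreRealRR_eq_of_within_out_true hω he]; exact hblue)

/-- An edge inside the red cluster of a root at `ω` lies inside `R ∪ armsTrueC ω`. -/
lemma MultiBaseE.within_cluster_subset {r : V} (hr : r ∈ R) (ω : Config (ι ⊕ ↥RR)) :
    within ends (cluster ends (coreRealRR ends A RR ζ ω) r) ⊆
      within ends (R ∪ armsTrueC A (armPart ω)) := by
  rintro e ⟨x, hx, y, hy, hxy⟩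
  refine ⟨x, ?_, y, ?_, hxy⟩
  · rcases hb.mem_root_or_true_of_mem_cluster ω hr hx with h' | ⟨i, hi, hx'⟩
    · exact Or.inl h'
    · exact Or.inr ⟨i, hi, hx'⟩
  · rcases hb.mem_root_or_true_of_mem_cluster ω hr hy with h' | ⟨i, hi, hy'⟩
    · exact Or.inl h'
    · exact Or.inr ⟨i, hi, hy'⟩

/-- An edge inside the blue cluster of a root at `ω` lies inside `R ∪ armsFalseC ω`. -/
lemma MultiBaseE.within_cluster_blue_subset {r : V} (hr : r ∈ R) (ω : Config (ι ⊕ ↥RR)) :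
    within ends (cluster ends (blue (coreRealRR ends A RR ζ ω)) r) ⊆
      within ends (R ∪ armsFalseC A (armPart ω)) := by
  rintro e ⟨x, hx, y, hy, hxy⟩
  refine ⟨x, ?_, y, ?_, hxy⟩
  · rcases hb.mem_root_or_false_of_mem_cluster_blue ω hr hx with h' | ⟨i, hi, hx'⟩
    · exact Or.inl h'
    · exact Or.inr ⟨i, hi, hx'⟩
  · rcases hb.mem_root_or_false_of_mem_cluster_blue ω hr hy with h' | ⟨i, hi, hy'⟩
    · exact Or.inl h'
    · exact Or.inr ⟨i, hi, hy'⟩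

end Cube

end LocRows

end Summit.Ventures.PercRepro2
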